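import Mathlib.Analysis.SpecialFunctions.Pow.Real

/-!
# `BalabanImbrieJaffe1984to88.BIJ88SlotBookkeepingSizeFree309` — T. Bałaban, J. Imbrie, A. Jaffe, *Effective action and cluster properties of
the abelian Higgs model*, Commun. Math. Phys. **114** (1988) 257–315 [BalabanImbrieJaffe1988]: p. 307 [PDF 51] L5–13 (Sect. 5.13), verbatim:
*"Functional derivatives hitting χ-factors farther than ½r(e_k) from Λ₁₀^{(k)c} produce factors e^{−cp(e_k)²} after integrating with respect to
A^{(k)″}, φ^{(k)″}. … Functional derivatives hitting e^{−V^{(k)}(Y)} yield factors e^β(L^kε/ε₀)^{1/4−α}. … Altogether we have small factors at each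
end of C_ω(α)"*, and (5.14.4) p. 309 [PDF 53] L21–28: *"Each t-derivative of a χ-factor in χ^w_{Λ,t} gives at least a factor e^β(L^kε/ε₀)^{1/4−α} …
the n-th derivative in t of χ(cp(e_k), A^{(k)}) is bounded by t^{−n} times a function bounded by a constant and supported in
c₁p(te_k) ≦ |A^{(k)}| ≦ c₂p(te_k). After integration over A^{(k)}, we obtain factors ct^{−n}e^{−cp(te_k)²}"* — **THE SLOT BOOKKEEPING OF ONE TERM OF
THE MASTER BOUND WITH SIZE-FREE LETTERS: `θ^{|H|}` SLOT BY SLOT, EVERYTHING ELSE AS PER-LEG GROWTH `a^{n}(n!)^s` TIMES THE LEG WEIGHTS**.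

The size-free counterpart of `BIJ88WalkTermCounting309.slots_mul_shells_le` (which needs `n_τ ≤ 2N₀`): located χ-slots `b ∈ Bloc` and `V`-slots
`Y ∈ Yloc` with `t`-derivative counts `m_τ`, leg counts `n_τ`, slot values `sv τ`, leg-weight products `W τ ≥ 0` (`= 1` when `n_τ = 0`) and
Gaussian shells `0 ≤ S_b ≤ (t e_k)^M θ_S` on the HIT χ-slots (`m_b ≠ 0 ∨ n_b ≠ 0`); GEVREY slot letters
`t^{m_b}·sv_b ≤ Aχ^{[m_b≠0]}·aχ^{n_b}(n_b!)^s·W_b` (free χ-slot `≤ 1`) and `sv_Y ≤ A_V^{[m_Y+n_Y≠0]}·θ_V^{m_Y+n_Y}·a_V^{n_Y}(n_Y!)^s·W_Y`.  Then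
(**`prod_slots_le_sizeFree`**)

  `(Π_τ sv τ)·Π_{b hit} S_b ≤ θ^{Σ_τ m_τ} · Aχ^{#{b : m_b≠0}} · A_V^{#{Y : m_Y+n_Y≠0}} · θ_S^{#{b hit}} · Π_τ a_τ^{n_τ}(n_τ!)^s W_τ`

(`a_b = aχ`, `a_Y = θ_V·a_V`) — `θ^{|H|}` from the `t`-derivatives as in print, ONE shell `θ_S` per hit χ-slot, `θ_V` per `V`-leg, and the factorial
growth left explicit per slot for `BIJ88LegFactorization309` (factorial removal by the block distances, shell sharing, factorization over the legs);
step 1 of HOME `lit-balaban-p36/ASSEMBLY-PLAN.md`.  `χ`-part `prod_chi_le`, `V`-part `prod_V_le`.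

statement-level skeleton of published theorems with citation tags; proofs where landed; nothing here is a claim about the Yang–Mills mass gap

PDF held: `paper:balaban1988-cmp114-bij-abelian-higgs-effective-action` p. 307 (p0051 L2–27), p. 309 (p0053 L12–30) re-read this session as text.

CITATION HEADER (lean-in-tree rule).  Part of the lit-balaban TYPED SKELETON (HOME `run/shared/lean/pub/lit-balaban/`), Phase 2, seat p36
(gen 23, unit `lit-balaban-p36`); rows **C2.Eq5.14.3-5.14.4** (member: size-free road, assembly step 1) and C2.Eq5.13.3-5.13.4 (member) of
`HOME/lit-balaban-r16/ROWS-C2-part2.md` (owner r16, referee ref-5).  Theorem-only (real inequalities over two abstract finite slot sets; Mathlib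
only); no definitions, no `Prop` facts; axioms standard.  HONEST SCOPE: bookkeeping of letters; the Gevrey letters themselves (χ: derivatives of the
cutoff profile, `BIJ88ChiSlotDsetBound309`; `V`: r16's typing gap #1) are hypotheses.  NOT summit progress; NOT continuum; NOT Clay.

REVISION v1.1 (doc-only, owner item D-owner-v2.389): the p. 307 L5 quotation above now carries print's region symbol `Λ₁₀^{(k)c}`; no
declaration changed.
-/

namespace Literature.MathematicalPhysics.QuantumFieldTheory.BalabanImbrieJaffe1984to88.BIJ88SlotBookkeepingSizeFree309

open Finset
open scoped BigOperators

/-- `Π_{x∈s} c^{[P x]} = c^{#{x ∈ s : P x}}`. [folklore] [cite: BalabanImbrieJaffe1988, §5.13 p.307 L5–13] -/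
theorem prod_pow_ite_eq_pow_card {β : Type*} (s : Finset β) (P : β → Prop) [DecidablePred P] (c : ℝ) :
    ∏ x ∈ s, c ^ (if P x then 1 else 0) = c ^ (s.filter P).card := by
  rw [prod_pow_eq_pow_sum, sum_boole, Nat.cast_id]

/-! ## §1  The χ-slots -/

/-- **ONE χ-SLOT**: with a shell `0 ≤ S ≤ (t e_k)^M θ_S` if the slot is hit (`m ≠ 0` `t`-derivatives or `n ≠ 0` legs), `m ≤ M`, `0 < t ≤ 1`,
`0 ≤ e_k ≤ θ ≤ 1`, `0 ≤ θ_S`, `sv ≥ 0`, and the Gevrey letter `t^{m} sv ≤ Aχ^{[m≠0]}·aχ^{n}(n!)^s·W` (a free slot has `sv ≤ 1`, `W = 1`):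
`sv·S^{[hit]} ≤ θ^{m}·Aχ^{[m≠0]}·θ_S^{[hit]}·aχ^{n}(n!)^s W` (p. 309: *"t^{−n} times a function … After integration … factors
ct^{−n}e^{−cp(te_k)²}"*: the shell turns `t^{−m}` into `e_k^{m} ≤ θ^{m}`). [cite: BalabanImbrieJaffe1988, §5.13 p.307 L5–13, (5.14.4) p.309 L21–28] -/
theorem chi_slot_le {sv W S t ek θ θS Aχ aχ s : ℝ} {m n M : ℕ} (ht0 : 0 < t) (ht1 : t ≤ 1) (hek0 : 0 ≤ ek) (hekθ : ek ≤ θ)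
    (hθ1 : θ ≤ 1) (hθS0 : 0 ≤ θS) (hsv0 : 0 ≤ sv) (hW1 : n = 0 → W = 1)
    (hsv : (m ≠ 0 ∨ n ≠ 0) → t ^ m * sv ≤ Aχ ^ (if m ≠ 0 then 1 else 0) * (aχ ^ n * ((n.factorial : ℕ) : ℝ) ^ s * W))
    (hsv1 : m = 0 → n = 0 → sv ≤ 1) (hS : S ≤ (t * ek) ^ M * θS) (hmM : m ≤ M) :
    sv * (if m ≠ 0 ∨ n ≠ 0 then S else 1) ≤
      θ ^ m * Aχ ^ (if m ≠ 0 then 1 else 0) * θS ^ (if m ≠ 0 ∨ n ≠ 0 then 1 else 0) * (aχ ^ n * ((n.factorial : ℕ) : ℝ) ^ s * W) := by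
  have hek1 : ek ≤ 1 := hekθ.trans hθ1
  by_cases hh : m ≠ 0 ∨ n ≠ 0
  · -- a hit slot: `sv·S = (t^m sv)(t^{M−m} e_k^M) θS ≤ Q θ^m θS`
    have hQ0 : 0 ≤ Aχ ^ (if m ≠ 0 then 1 else 0) * (aχ ^ n * ((n.factorial : ℕ) : ℝ) ^ s * W) :=
      le_trans (mul_nonneg (pow_nonneg ht0.le _) hsv0) (hsv hh)
    have h2 : sv * ((t * ek) ^ M * θS) = (t ^ m * sv) * (t ^ (M - m) * ek ^ M) * θS := by
      rw [mul_pow]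
      have : t ^ M = t ^ m * t ^ (M - m) := by rw [← pow_add, Nat.add_sub_cancel' hmM]
      rw [this]; ring
    have h3 : t ^ (M - m) * ek ^ M ≤ θ ^ m :=
      calc t ^ (M - m) * ek ^ M ≤ 1 * ek ^ m :=
            mul_le_mul (pow_le_one₀ ht0.le ht1) (pow_le_pow_of_le_one hek0 hek1 hmM) (pow_nonneg hek0 _) zero_le_one
        _ ≤ θ ^ m := by rw [one_mul]; exact pow_le_pow_left₀ hek0 hekθ _
    rw [if_pos hh, if_pos hh, pow_one]
    calc sv * S ≤ sv * ((t * ek) ^ M * θS) := mul_le_mul_of_nonneg_left hS hsv0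
      _ = (t ^ m * sv) * (t ^ (M - m) * ek ^ M) * θS := h2
      _ ≤ (Aχ ^ (if m ≠ 0 then 1 else 0) * (aχ ^ n * ((n.factorial : ℕ) : ℝ) ^ s * W)) * θ ^ m * θS :=
          mul_le_mul_of_nonneg_right (mul_le_mul (hsv hh) h3 (by positivity) hQ0) hθS0
      _ = _ := by ring
  · -- a free slot
    have hm0 : m = 0 := by by_contra h'; exact hh (Or.inl h')
    have hn0 : n = 0 := by by_contra h'; exact hh (Or.inr h')
    rw [if_neg hh, if_neg hh, mul_one]
    simp only [hm0, hn0, ne_eq, not_true_eq_false, if_false, pow_zero, Nat.factorial_zero, Nat.cast_one, Real.one_rpow,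
      hW1 hn0, mul_one]
    exact hsv1 hm0 hn0

/-- **THE χ-SLOTS**: with shells `0 ≤ S_b ≤ (t e_k)^M θ_S` on the hit slots, `t`-counts `m_b ≤ M`, `0 < t ≤ 1`, `0 ≤ e_k ≤ θ ≤ 1`, `0 ≤ θ_S`, and
the Gevrey letter `t^{m_b} sv_b ≤ Aχ^{[m_b≠0]}·aχ^{n_b}(n_b!)^s·W_b` (a free slot has `sv_b ≤ 1`, `W_b = 1`):
`(Π_b sv_b)·Π_{b hit} S_b ≤ θ^{Σ_b m_b}·Aχ^{#{m_b≠0}}·θ_S^{#{hit}}·Π_b aχ^{n_b}(n_b!)^s W_b` (p. 309: *"t^{−n} times a function … After integration …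
factors ct^{−n}e^{−cp(te_k)²}"*: the shell turns `t^{−m}` into `e_k^{m} ≤ θ^{m}`). [cite: BalabanImbrieJaffe1988, §5.13 p.307 L5–13, (5.14.4) p.309 L21–28] -/
theorem prod_chi_le {β : Type*} [DecidableEq β] (Bloc : Finset β) (m n : β → ℕ) (sv W S : β → ℝ)
    {t ek θ θS Aχ aχ s : ℝ} {M : ℕ} (ht0 : 0 < t) (ht1 : t ≤ 1) (hek0 : 0 ≤ ek) (hekθ : ek ≤ θ) (hθ1 : θ ≤ 1) (hθS0 : 0 ≤ θS)
    (hsv0 : ∀ b ∈ Bloc, 0 ≤ sv b) (hW1 : ∀ b ∈ Bloc, n b = 0 → W b = 1)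
    (hsv : ∀ b ∈ Bloc, (m b ≠ 0 ∨ n b ≠ 0) →
      t ^ m b * sv b ≤ Aχ ^ (if m b ≠ 0 then 1 else 0) * (aχ ^ n b * ((n b).factorial : ℝ) ^ s * W b))
    (hsv1 : ∀ b ∈ Bloc, m b = 0 → n b = 0 → sv b ≤ 1)
    (hS0 : ∀ b ∈ Bloc, 0 ≤ S b) (hS : ∀ b ∈ Bloc, S b ≤ (t * ek) ^ M * θS) (hmM : ∀ b ∈ Bloc, m b ≤ M) :
    (∏ b ∈ Bloc, sv b) * ∏ b ∈ Bloc.filter (fun b => m b ≠ 0 ∨ n b ≠ 0), S b ≤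
      θ ^ (∑ b ∈ Bloc, m b) * Aχ ^ (Bloc.filter fun b => m b ≠ 0).card * θS ^ (Bloc.filter fun b => m b ≠ 0 ∨ n b ≠ 0).card *
        ∏ b ∈ Bloc, (aχ ^ n b * ((n b).factorial : ℝ) ^ s * W b) := by
  -- merge the shells into the slot factors
  set f : β → ℝ := fun b => sv b * if m b ≠ 0 ∨ n b ≠ 0 then S b else 1 with hf
  have hmerge : (∏ b ∈ Bloc, sv b) * ∏ b ∈ Bloc.filter (fun b => m b ≠ 0 ∨ n b ≠ 0), S b = ∏ b ∈ Bloc, f b := by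
    rw [prod_filter, ← prod_mul_distrib]
  -- the per-slot target
  set g : β → ℝ := fun b => θ ^ m b * Aχ ^ (if m b ≠ 0 then 1 else 0) * θS ^ (if m b ≠ 0 ∨ n b ≠ 0 then 1 else 0) *
    (aχ ^ n b * ((n b).factorial : ℝ) ^ s * W b) with hg
  have hf0 : ∀ b ∈ Bloc, 0 ≤ f b := fun b hb => by
    simp only [hf]
    split_ifs
    · exact mul_nonneg (hsv0 b hb) (hS0 b hb)
    · rw [mul_one]; exact hsv0 b hb
  have hle : ∀ b ∈ Bloc, f b ≤ g b := fun b hb =>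
    chi_slot_le ht0 ht1 hek0 hekθ hθ1 hθS0 (hsv0 b hb) (hW1 b hb) (hsv b hb) (hsv1 b hb) (hS b hb) (hmM b hb)
  rw [hmerge]
  refine (prod_le_prod hf0 hle).trans (le_of_eq ?_)
  simp only [hg, prod_mul_distrib, prod_pow_eq_pow_sum, sum_boole, Nat.cast_id]

/-! ## §2  The `V`-slots -/

/-- **ONE `V`-SLOT**: with the letter `sv ≤ A_V·θ_V^{m+n}·a_V^{n}(n!)^s·W` (`A_V ≥ 1`, `0 ≤ θ_V ≤ θ`, `a_V, W ≥ 0`):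
`sv ≤ θ^{m}·A_V·(θ_V a_V)^{n}(n!)^s W` — `θ` per `t`-derivative, `θ_V` per leg (p. 307: *"Functional derivatives hitting e^{−V^{(k)}(Y)} yield
factors e^β(L^kε/ε₀)^{1/4−α}"*). [cite: BalabanImbrieJaffe1988, §5.13 p.307 L10–11, (5.14.4) p.309 L15–21] -/
theorem V_slot_le {sv W θ θV AV aV s : ℝ} {m n : ℕ} (hθV0 : 0 ≤ θV) (hθVθ : θV ≤ θ) (hAV : 1 ≤ AV) (haV : 0 ≤ aV) (hW0 : 0 ≤ W)
    (hsv : sv ≤ AV * θV ^ (m + n) * (aV ^ n * ((n.factorial : ℕ) : ℝ) ^ s * W)) :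
    sv ≤ θ ^ m * AV * ((θV * aV) ^ n * ((n.factorial : ℕ) : ℝ) ^ s * W) := by
  refine hsv.trans ?_
  rw [pow_add, mul_pow]
  have h1 : θV ^ m ≤ θ ^ m := pow_le_pow_left₀ hθV0 hθVθ _
  have h2 : 0 ≤ AV := zero_le_one.trans hAV
  have h3 : 0 ≤ aV ^ n * ((n.factorial : ℕ) : ℝ) ^ s * W :=
    mul_nonneg (mul_nonneg (pow_nonneg haV _) (Real.rpow_nonneg (Nat.cast_nonneg _) _)) hW0
  calc AV * (θV ^ m * θV ^ n) * (aV ^ n * ((n.factorial : ℕ) : ℝ) ^ s * W)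
      = θV ^ m * (AV * (θV ^ n * (aV ^ n * ((n.factorial : ℕ) : ℝ) ^ s * W))) := by ring
    _ ≤ θ ^ m * (AV * (θV ^ n * (aV ^ n * ((n.factorial : ℕ) : ℝ) ^ s * W))) :=
        mul_le_mul_of_nonneg_right h1 (mul_nonneg h2 (mul_nonneg (pow_nonneg hθV0 _) h3))
    _ = _ := by ring

/-- **THE `V`-SLOTS**: with the letter `sv_Y ≤ A_V·θ_V^{m_Y+n_Y}·a_V^{n_Y}(n_Y!)^s·W_Y` (`A_V ≥ 1` the size of an undifferentiated `V`-slot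
factor — a per-slot constant, paid per cube by the assembly; `0 ≤ θ_V ≤ θ`, `a_V, W, sv ≥ 0`):
`Π_Y sv_Y ≤ θ^{Σ_Y m_Y}·A_V^{|Yloc|}·Π_Y (θ_V a_V)^{n_Y}(n_Y!)^s W_Y` (p. 307: *"Functional derivatives hitting e^{−V^{(k)}(Y)} yield factors
e^β(L^kε/ε₀)^{1/4−α}"* — one per leg). [cite: BalabanImbrieJaffe1988, §5.13 p.307 L10–11, (5.14.4) p.309 L15–21] -/
theorem prod_V_le {υ : Type*} [DecidableEq υ] (Yloc : Finset υ) (m n : υ → ℕ) (sv W : υ → ℝ) {θ θV AV aV s : ℝ}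
    (hθV0 : 0 ≤ θV) (hθVθ : θV ≤ θ) (hAV : 1 ≤ AV) (haV : 0 ≤ aV) (hsv0 : ∀ Y ∈ Yloc, 0 ≤ sv Y) (hW0 : ∀ Y ∈ Yloc, 0 ≤ W Y)
    (hsv : ∀ Y ∈ Yloc, sv Y ≤ AV * θV ^ (m Y + n Y) * (aV ^ n Y * ((n Y).factorial : ℝ) ^ s * W Y)) :
    ∏ Y ∈ Yloc, sv Y ≤ θ ^ (∑ Y ∈ Yloc, m Y) * AV ^ Yloc.card *
      ∏ Y ∈ Yloc, ((θV * aV) ^ n Y * ((n Y).factorial : ℝ) ^ s * W Y) := by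
  set g : υ → ℝ := fun Y => θ ^ m Y * AV * ((θV * aV) ^ n Y * ((n Y).factorial : ℝ) ^ s * W Y)
    with hg
  have hle : ∀ Y ∈ Yloc, sv Y ≤ g Y := fun Y hY => V_slot_le hθV0 hθVθ hAV haV (hW0 Y hY) (hsv Y hY)
  refine (prod_le_prod hsv0 hle).trans (le_of_eq ?_)
  simp only [hg, prod_mul_distrib, prod_pow_eq_pow_sum, prod_const]

/-! ## §3  All located slots -/

/-- **THE SLOT BOOKKEEPING OF ONE TERM, SIZE-FREE**: χ-slots and `V`-slots together (hypotheses of `prod_chi_le` and `prod_V_le`):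
`(Π_b sv_b)(Π_Y sv_Y)·Π_{b hit} S_b ≤ θ^{Σ_b m_b + Σ_Y m_Y}·Aχ^{#{m_b≠0}}·A_V^{|Yloc|}·θ_S^{#{b hit}}·(Π_b aχ^{n_b}(n_b!)^s W_b)·
(Π_Y (θ_V a_V)^{n_Y}(n_Y!)^s W_Y)` — `θ^{|H|}` once `Σ_τ m_τ = |H|` (the `t`-derivatives located slot by slot), one shell per hit χ-slot, `θ_V` per
`V`-leg, `A_V` per located `V`-slot (paid per cube by the assembly), and per-slot Gevrey growth against the leg weights, to be removed leg by leg
(`BIJ88LegFactorization309`).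
[cite: BalabanImbrieJaffe1988, §5.13 p.307 L5–13, (5.14.4) p.309 L12–28] -/
theorem prod_slots_le_sizeFree {β υ : Type*} [DecidableEq β] [DecidableEq υ] (Bloc : Finset β) (Yloc : Finset υ)
    (m n : β → ℕ) (mY nY : υ → ℕ) (sv W S : β → ℝ) (svY WY : υ → ℝ)
    {t ek θ θS θV Aχ AV aχ aV s : ℝ} {M : ℕ} (ht0 : 0 < t) (ht1 : t ≤ 1) (hek0 : 0 ≤ ek) (hekθ : ek ≤ θ) (hθ1 : θ ≤ 1) (hθS0 : 0 ≤ θS)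
    (hθV0 : 0 ≤ θV) (hθVθ : θV ≤ θ) (hAV : 1 ≤ AV) (haV : 0 ≤ aV)
    (hsv0 : ∀ b ∈ Bloc, 0 ≤ sv b) (hW1 : ∀ b ∈ Bloc, n b = 0 → W b = 1)
    (hsv : ∀ b ∈ Bloc, (m b ≠ 0 ∨ n b ≠ 0) →
      t ^ m b * sv b ≤ Aχ ^ (if m b ≠ 0 then 1 else 0) * (aχ ^ n b * ((n b).factorial : ℝ) ^ s * W b))
    (hsv1 : ∀ b ∈ Bloc, m b = 0 → n b = 0 → sv b ≤ 1)
    (hS0 : ∀ b ∈ Bloc, 0 ≤ S b) (hS : ∀ b ∈ Bloc, S b ≤ (t * ek) ^ M * θS) (hmM : ∀ b ∈ Bloc, m b ≤ M)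
    (hsvY0 : ∀ Y ∈ Yloc, 0 ≤ svY Y) (hWY0 : ∀ Y ∈ Yloc, 0 ≤ WY Y)
    (hsvY : ∀ Y ∈ Yloc, svY Y ≤ AV * θV ^ (mY Y + nY Y) * (aV ^ nY Y * ((nY Y).factorial : ℝ) ^ s * WY Y)) :
    (∏ b ∈ Bloc, sv b) * (∏ Y ∈ Yloc, svY Y) * ∏ b ∈ Bloc.filter (fun b => m b ≠ 0 ∨ n b ≠ 0), S b ≤
      θ ^ (∑ b ∈ Bloc, m b + ∑ Y ∈ Yloc, mY Y) * Aχ ^ (Bloc.filter fun b => m b ≠ 0).card *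
        AV ^ Yloc.card * θS ^ (Bloc.filter fun b => m b ≠ 0 ∨ n b ≠ 0).card *
        ((∏ b ∈ Bloc, (aχ ^ n b * ((n b).factorial : ℝ) ^ s * W b)) *
          ∏ Y ∈ Yloc, ((θV * aV) ^ nY Y * ((nY Y).factorial : ℝ) ^ s * WY Y)) := by
  have hθ0 : 0 ≤ θ := hek0.trans hekθ
  have h1 := prod_chi_le Bloc m n sv W S ht0 ht1 hek0 hekθ hθ1 hθS0 hsv0 hW1 hsv hsv1 hS0 hS hmM
  have h2 := prod_V_le Yloc mY nY svY WY hθV0 hθVθ hAV haV hsvY0 hWY0 hsvY (s := s)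
  have hA0 : 0 ≤ (∏ b ∈ Bloc, sv b) * ∏ b ∈ Bloc.filter (fun b => m b ≠ 0 ∨ n b ≠ 0), S b :=
    mul_nonneg (prod_nonneg hsv0) (prod_nonneg fun b hb => hS0 b (mem_filter.1 hb).1)
  have hB0 : 0 ≤ ∏ Y ∈ Yloc, svY Y := prod_nonneg hsvY0
  calc (∏ b ∈ Bloc, sv b) * (∏ Y ∈ Yloc, svY Y) * ∏ b ∈ Bloc.filter (fun b => m b ≠ 0 ∨ n b ≠ 0), S b
      = ((∏ b ∈ Bloc, sv b) * ∏ b ∈ Bloc.filter (fun b => m b ≠ 0 ∨ n b ≠ 0), S b) * ∏ Y ∈ Yloc, svY Y := by ring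
    _ ≤ (θ ^ (∑ b ∈ Bloc, m b) * Aχ ^ (Bloc.filter fun b => m b ≠ 0).card * θS ^ (Bloc.filter fun b => m b ≠ 0 ∨ n b ≠ 0).card *
          ∏ b ∈ Bloc, (aχ ^ n b * ((n b).factorial : ℝ) ^ s * W b)) *
        (θ ^ (∑ Y ∈ Yloc, mY Y) * AV ^ Yloc.card *
          ∏ Y ∈ Yloc, ((θV * aV) ^ nY Y * ((nY Y).factorial : ℝ) ^ s * WY Y)) :=
        mul_le_mul h1 h2 hB0 (hA0.trans h1)
    _ = _ := by rw [pow_add]; ring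

end Literature.MathematicalPhysics.QuantumFieldTheory.BalabanImbrieJaffe1984to88.BIJ88SlotBookkeepingSizeFree309
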